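import Summits.QuantumFields.BalabanUV.Beta.GAN24.DirichletVertexStarBox
import Summits.QuantumFields.BalabanUV.Beta.GAN24.DirichletVertexLocalW
import Summits.QuantumFields.BalabanUV.Beta.GAN24.DirichletVertexPiece

/-!
# `BalabanUV.Beta.GAN24.DirichletVertexWindowLocal` — binder row G-an2-4 / (CONV-C), road P2 PART IV, leaf L14 (the torus transfer), FILE U5a:
# THE UNWEIGHTED WINDOW HESSIANS WITH STAR-BOX CURRENCIES — product windows and isolated pieces bounded by the star box sums of their own
# vertex instead of the global budgets (unit b2b-balaban-gan24-p2, gen 27, v1)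

HONEST FRAMING (cell contract, verbatim): «discharging `BetaPertH` makes Bałaban's UV stability UNCONDITIONAL — a real constructive-QFT
result; it is NOT the continuum limit and NOT the Clay problem.»  SUPPLIER module under the T⁴-DAG sub-row `T4-U1a.S-NE2-D1-DIRICHLET°`.
`DirichletVertexLocalW.vertexT_plain_hessian_le'` (p246354) and `DirichletVertexPiece.piece_hessian_le` (p245486) close the model bound
`local_hessian_le_shift` (p244818) with the GLOBAL budgets, so the census of `DirichletVertexDomSum` costs `20·|Tor M|` (LOCATED L27-1).
THIS FILE closes the same model bound with the STAR BOX SUMS `boxSum F σ b` of `DirichletVertexStarBox` (p247556) — `F ∈ {𝟙_Ω|Δu|²,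
|∂₀u|², |∂₁u|², |u|²}` — which sum over all vertices to `4·Σ_x F` whatever the volume.

## Contents ([folklore]; 0 sorry)
* §1 `window_G_le_box`, `Et_UpT_le_box`, `sqSum_UpT_le_box` (the three window currencies of a translated window are star-box sub-sums);
  **`plainWT_hessian_le_box`**.
* §2 `Et_Um_le_box`, **`pieceW_hessian_le_box`**.

ABSOLUTE RULE (cell, verbatim): «No internally-minted statement may enter as a cited fact. Every hypothesis is either kernel-proved in
this package or a verbatim quotation of a PUBLISHED theorem with page reference. The manuscript(s) under audit are NOT citable for
their own disputed steps — they are the thing under adjudication; programme-internal (2001/route/tribunal) claims are never citable.»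
Nothing printed is a hypothesis.  NOT CLAIMED: the volume-uniform END (next files); NOT NE2, (CONV-C), `BetaPertH`, continuum, Clay.
«not in print; our proof attempt».  HONEST DEPENDENCY: continuum YM on T⁴ ⇐ BetaPertH ∧ nine spine estimates (0/9 proved); BetaPertH ⇐
(D1) ∧ (D4) ∧ CAP+tail; G-an2-4 gates asym, D1 and NE2/3/4.
-/

noncomputable section

open scoped BigOperators ComplexConjugate Matrix
open Finset

namespace Summit.QuantumFields.BalabanUV.Beta.GAN24.DirichletVertexWindowLocal

open Literature.MathematicalPhysics.QuantumFieldTheory.Balaban1983to89.B5Prop11Plancherel (Tor fine unitVec)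
open Literature.MathematicalPhysics.QuantumFieldTheory.Balaban1983to89.B5Action121 (sdiff LapS)
open Literature.MathematicalPhysics.QuantumFieldTheory.Balaban1983to89.B5Prop11Lower (nsq nsq_nonneg)
open Summit.QuantumFields.BalabanUV.Beta.GAN24.DirichletBoxRegularity (Pdir)
open Summit.QuantumFields.BalabanUV.Beta.GAN24.DirichletBoxTrace (blockReg)
open DirichletRingEnergies (hb vb lap Et sqSum Et_nonneg sqSum_nonneg hb_nonneg vb_nonneg)
open DirichletRingCutoff (tIdx one_le_tIdx)
open DirichletRingHessianIdentity (d1 d2)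
open DirichletRingHessianLocal (AxisSep indW indW_mem)
open DirichletRingHessianLocalShift (local_hessian_le_shift)
open DirichletVertexChart
open DirichletVertexPullback
open DirichletVertexLocal (Wprod axisSep_Wprod)
open DirichletVertexLocalT (UpT WprodT axisSep_WprodT plainWT sum_plainWT_mul lap_UpT hb_UpT vb_UpT Pdir_embT_fst Pdir_embT_snd)
open DirichletVertexPiece (Quad IsolatedAt Um pieceW sum_pieceW_mul hess_Um_eq hb_Um_le vb_Um_le normSq_Um_le blockReg_of_quad Um_of_not)
open DirichletVertexStarBox (boxSum sum_sub_range_le window_le_boxSum F_emb_congr)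

variable (n : ℕ) [NeZero n] (M : Fin 2 → ℕ) [hM : ∀ μ, NeZero (M μ)]

/-! ## §1 Translated product windows -/

section Window

variable {S : Tor M → Prop} {σ : Fin 2 → Bool} {b : Tor M} {A B : Bool → Prop} [DecidablePred A] [DecidablePred B]
  {u : Tor (fine n M) → ℂ} {τ₀ τ₁ : ℤ}

/-- the window Laplacian currency is a star-box sub-sum of `𝟙_Ω|Δu|²`: under `hW` on `Q_K` and the window inside `[−n, n)²`,
`n⁴·sqSum (𝟙_W·|Δu∘emb/n²|²) K ≤ boxSum (𝟙_Ω|Δu|²)`. [folklore] -/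
theorem window_G_le_box [DecidablePred S] {K : ℕ}
    (hW : ∀ i j : ℤ, tIdx i ≤ K → tIdx j ≤ K → (blockReg n M S (emb n M σ b (i + τ₀) (j + τ₁)) ↔ WprodT A B τ₀ τ₁ i j))
    (h₀ : -(n : ℤ) ≤ -(K : ℤ) + τ₀) (h₀' : τ₀ + K ≤ n) (h₁ : -(n : ℤ) ≤ -(K : ℤ) + τ₁) (h₁' : τ₁ + K ≤ n) :
    (n : ℝ) ^ 4 * sqSum (fun i j => indW (WprodT A B τ₀ τ₁) i j
        * ‖(LapS (fine n M) (n : ℂ) *ᵥ u) (emb n M σ b (i + τ₀) (j + τ₁)) / (n : ℂ) ^ 2‖ ^ 2) K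
      ≤ boxSum n M (fun x => if blockReg n M S x then ‖(LapS (fine n M) (n : ℂ) *ᵥ u) x‖ ^ 2 else 0) σ b := by
  have hn0 : (0 : ℝ) < n := by exact_mod_cast Nat.pos_of_ne_zero (NeZero.ne n)
  have hn4 : (0 : ℝ) < (n : ℝ) ^ 4 := by positivity
  set P : Tor (fine n M) → ℝ := fun x => if blockReg n M S x then ‖(LapS (fine n M) (n : ℂ) *ᵥ u) x‖ ^ 2 else 0 with hP
  have hP0 : ∀ x, 0 ≤ P x := fun x => by rw [hP]; simp only; split_ifs <;> positivity
  have hterm : ∀ t ∈ range (2 * K), ∀ s ∈ range (2 * K),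
      (n : ℝ) ^ 4 * (indW (WprodT A B τ₀ τ₁) (-(K : ℤ) + s) (-(K : ℤ) + t)
        * ‖(LapS (fine n M) (n : ℂ) *ᵥ u) (emb n M σ b (-(K : ℤ) + s + τ₀) (-(K : ℤ) + t + τ₁)) / (n : ℂ) ^ 2‖ ^ 2)
        ≤ P (emb n M σ b (-(K : ℤ) + s + τ₀) (-(K : ℤ) + t + τ₁)) := by
    intro t ht s hs
    simp only [mem_range] at ht hs
    rw [indW, hP]
    simp only
    by_cases hw : WprodT A B τ₀ τ₁ (-(K : ℤ) + s) (-(K : ℤ) + t)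
    · have hΩ := (hW _ _ (DirichletVertexLocalW.tIdx_range_le hs) (DirichletVertexLocalW.tIdx_range_le ht)).mpr hw
      rw [if_pos hw, if_pos hΩ, one_mul, norm_div, div_pow, norm_pow, Complex.norm_natCast, ← pow_mul, mul_div_cancel₀ _ hn4.ne']
    · rw [if_neg hw, zero_mul, mul_zero]; exact hP0 _
  calc (n : ℝ) ^ 4 * sqSum _ K
      = ∑ t ∈ range (2 * K), ∑ s ∈ range (2 * K), (n : ℝ) ^ 4 * (indW (WprodT A B τ₀ τ₁) (-(K : ℤ) + s) (-(K : ℤ) + t)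
          * ‖(LapS (fine n M) (n : ℂ) *ᵥ u) (emb n M σ b (-(K : ℤ) + s + τ₀) (-(K : ℤ) + t + τ₁)) / (n : ℂ) ^ 2‖ ^ 2) := by
        rw [sqSum, mul_sum]; simp only [mul_sum]
    _ ≤ ∑ t ∈ range (2 * K), ∑ s ∈ range (2 * K), P (emb n M σ b (-(K : ℤ) + s + τ₀) (-(K : ℤ) + t + τ₁)) :=
        sum_le_sum fun t ht => sum_le_sum fun s hs => hterm t ht s hs
    _ ≤ boxSum n M P σ b := window_le_boxSum n M hP0 σ b h₀ h₀' h₁ h₁'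

/-- the window ring energy is a star-box sub-sum: `n²·Et (UpT u τ) K ≤ boxSum|∂₀u|² + boxSum|∂₁u|²` for `K + 1 ≤ n + τ_ν`, `τ_ν + K + 1 ≤ n`.
[folklore] -/
theorem Et_UpT_le_box {K : ℕ} (h₀ : (K : ℤ) + 1 ≤ n + τ₀) (h₀' : τ₀ + K + 1 ≤ n) (h₁ : (K : ℤ) + 1 ≤ n + τ₁) (h₁' : τ₁ + K + 1 ≤ n) :
    (n : ℝ) ^ 2 * Et (UpT n M σ b u τ₀ τ₁) K
      ≤ boxSum n M (fun x => ‖(sdiff (fine n M) (n : ℂ) 0 *ᵥ u) x‖ ^ 2) σ b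
        + boxSum n M (fun x => ‖(sdiff (fine n M) (n : ℂ) 1 *ᵥ u) x‖ ^ 2) σ b := by
  have hn0 : (0 : ℝ) < n := by exact_mod_cast Nat.pos_of_ne_zero (NeZero.ne n)
  have hn2 : (n : ℝ) ^ 2 ≠ 0 := by positivity
  obtain ⟨hb0, hb1⟩ := bsh_mem σ 0
  obtain ⟨hv0, hv1⟩ := bsh_mem σ 1
  obtain ⟨a, ha⟩ : ∃ a : ℕ, (a : ℤ) = τ₀ + bsh σ 0 + n - K - 1 := ⟨(τ₀ + bsh σ 0 + n - K - 1).toNat, by omega⟩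
  obtain ⟨a', ha'⟩ : ∃ a' : ℕ, (a' : ℤ) = τ₀ + n - K := ⟨(τ₀ + n - K).toNat, by omega⟩
  obtain ⟨c, hc⟩ : ∃ c : ℕ, (c : ℤ) = τ₁ + n - K := ⟨(τ₁ + n - K).toNat, by omega⟩
  obtain ⟨c', hc'⟩ : ∃ c' : ℕ, (c' : ℤ) = τ₁ + bsh σ 1 + n - K - 1 := ⟨(τ₁ + bsh σ 1 + n - K - 1).toNat, by omega⟩
  rw [Et_eq_rect, mul_add]
  refine add_le_add ?_ ?_
  · set g : ℕ → ℕ → ℝ := fun s t => ‖(sdiff (fine n M) (n : ℂ) 0 *ᵥ u) (emb n M σ b (-(n : ℤ) + s) (-(n : ℤ) + t))‖ ^ 2 with hg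
    calc (n : ℝ) ^ 2 * EtH (UpT n M σ b u τ₀ τ₁) K = ∑ t ∈ range (2 * K), ∑ s ∈ range (2 * K + 1), g (s + a) (t + c) := by
          unfold EtH
          rw [mul_sum]
          refine sum_congr rfl fun t _ => ?_
          rw [mul_sum]
          refine sum_congr rfl fun s _ => ?_
          rw [hb_UpT, hb_Up_eq, mul_div_cancel₀ _ hn2, hg]
          exact F_emb_congr n M (fun x => ‖(sdiff (fine n M) (n : ℂ) 0 *ᵥ u) x‖ ^ 2) σ b (by push_cast; omega) (by push_cast; omega)
      _ ≤ _ := sum_sub_range_le g (fun _ _ => sq_nonneg _) (by omega) (by omega)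
  · set g : ℕ → ℕ → ℝ := fun s t => ‖(sdiff (fine n M) (n : ℂ) 1 *ᵥ u) (emb n M σ b (-(n : ℤ) + s) (-(n : ℤ) + t))‖ ^ 2 with hg
    calc (n : ℝ) ^ 2 * EtV (UpT n M σ b u τ₀ τ₁) K = ∑ s ∈ range (2 * K), ∑ t ∈ range (2 * K + 1), g (s + a') (t + c') := by
          unfold EtV
          rw [mul_sum]
          refine sum_congr rfl fun s _ => ?_
          rw [mul_sum]
          refine sum_congr rfl fun t _ => ?_
          rw [vb_UpT, vb_Up_eq, mul_div_cancel₀ _ hn2, hg]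
          exact F_emb_congr n M (fun x => ‖(sdiff (fine n M) (n : ℂ) 1 *ᵥ u) x‖ ^ 2) σ b (by push_cast; omega) (by push_cast; omega)
      _ = ∑ t ∈ range (2 * K + 1), ∑ s ∈ range (2 * K), g (s + a') (t + c') := sum_comm
      _ ≤ _ := sum_sub_range_le g (fun _ _ => sq_nonneg _) (by omega) (by omega)

omit [NeZero n] hM in
/-- the window mass is a star-box sub-sum: `sqSum |UpT u τ|² K ≤ boxSum |u|²`. [folklore] -/
theorem sqSum_UpT_le_box {K : ℕ} (h₀ : -(n : ℤ) ≤ -(K : ℤ) + τ₀) (h₀' : τ₀ + K ≤ n) (h₁ : -(n : ℤ) ≤ -(K : ℤ) + τ₁) (h₁' : τ₁ + K ≤ n) :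
    sqSum (fun i j => ‖UpT n M σ b u τ₀ τ₁ i j‖ ^ 2) K ≤ boxSum n M (fun x => ‖u x‖ ^ 2) σ b := by
  have h := window_le_boxSum n M (F := fun x => ‖u x‖ ^ 2) (fun _ => sq_nonneg _) σ b h₀ h₀' h₁ h₁'
  refine le_trans (le_of_eq ?_) h
  unfold sqSum UpT Up
  refine sum_congr rfl fun t _ => sum_congr rfl fun s _ => ?_
  exact F_emb_congr n M (fun x => ‖u x‖ ^ 2) σ b (by ring) (by ring)

/-- **THE UNWEIGHTED HESSIAN OF A PRODUCT WINDOW WITH STAR-BOX CURRENCIES**: for `u` vanishing off `Ω`, `1 ≤ L`, `K = 4L + c + 1`,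
`K + 1 ≤ n + τ_ν`, `τ_ν + K + 1 ≤ n`, `hW` on `Q_K`, plateau `P = 2L + c − 1`:
`Σ_μ Σ_x plainWT(x)|∂ᴴ_μ∂_μu|² ≤ 2·boxSum(𝟙_Ω|Δu|²) + 32(n/L)²·(boxSum|∂₀u|² + boxSum|∂₁u|²) + 16(n/L)⁴·boxSum|u|²`. [folklore] -/
theorem plainWT_hessian_le_box [DecidablePred S] (hu : ∀ x, ¬ blockReg n M S x → u x = 0) {L c : ℕ} (hL : 1 ≤ L)
    (hW : ∀ i j : ℤ, tIdx i ≤ (4 * L + c + 1 : ℕ) → tIdx j ≤ (4 * L + c + 1 : ℕ) →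
      (blockReg n M S (emb n M σ b (i + τ₀) (j + τ₁)) ↔ WprodT A B τ₀ τ₁ i j))
    (hτ₀ : ((4 * L + c + 1 : ℕ) : ℤ) + 1 ≤ n + τ₀) (hτ₀' : τ₀ + (4 * L + c + 1 : ℕ) + 1 ≤ n)
    (hτ₁ : ((4 * L + c + 1 : ℕ) : ℤ) + 1 ≤ n + τ₁) (hτ₁' : τ₁ + (4 * L + c + 1 : ℕ) + 1 ≤ n) :
    ∑ μ, ∑ x, plainWT n M (σ, b) A B τ₀ τ₁ (2 * L + c - 1) x * ‖(Pdir (fine n M) (n : ℂ) μ *ᵥ u) x‖ ^ 2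
      ≤ 2 * boxSum n M (fun x => if blockReg n M S x then ‖(LapS (fine n M) (n : ℂ) *ᵥ u) x‖ ^ 2 else 0) σ b
        + 32 * ((n : ℝ) / L) ^ 2 * (boxSum n M (fun x => ‖(sdiff (fine n M) (n : ℂ) 0 *ᵥ u) x‖ ^ 2) σ b
          + boxSum n M (fun x => ‖(sdiff (fine n M) (n : ℂ) 1 *ᵥ u) x‖ ^ 2) σ b)
        + 16 * ((n : ℝ) / L) ^ 4 * boxSum n M (fun x => ‖u x‖ ^ 2) σ b := by
  set K : ℕ := 4 * L + c + 1 with hKdef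
  set P : ℕ := 2 * L + c - 1 with hP
  have hn0 : (0 : ℝ) < n := by exact_mod_cast Nat.pos_of_ne_zero (NeZero.ne n)
  have hL0 : (0 : ℝ) < L := by exact_mod_cast hL
  set U : ℤ → ℤ → ℂ := UpT n M σ b u τ₀ τ₁ with hU
  set G : ℤ → ℤ → ℂ := fun i j => (LapS (fine n M) (n : ℂ) *ᵥ u) (emb n M σ b (i + τ₀) (j + τ₁)) / (n : ℂ) ^ 2 with hG
  have hUW : ∀ i j : ℤ, tIdx i ≤ 4 * (L : ℤ) + c → tIdx j ≤ 4 * (L : ℤ) + c → ¬ WprodT A B τ₀ τ₁ i j → U i j = 0 := by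
    intro i j hi hj hw
    have hKc : ((4 * L + c + 1 : ℕ) : ℤ) = 4 * (L : ℤ) + c + 1 := by push_cast; ring
    exact hu _ (fun h => hw ((hW i j (by rw [hKc]; omega) (by rw [hKc]; omega)).mp h))
  have hEq : ∀ i j : ℤ, tIdx i ≤ 4 * (L : ℤ) + c + 1 → tIdx j ≤ 4 * (L : ℤ) + c + 1 → WprodT A B τ₀ τ₁ i j → lap U i j = G i j := by
    intro i j _ _ _
    have hn2 : (n : ℂ) ^ 2 ≠ 0 := pow_ne_zero 2 (by exact_mod_cast NeZero.ne n)
    show lap U i j = (LapS (fine n M) (n : ℂ) *ᵥ u) (emb n M σ b (i + τ₀) (j + τ₁)) / (n : ℂ) ^ 2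
    rw [hU, lap_UpT, LapS_emb, mul_div_cancel_left₀ _ hn2]
  have hloc := local_hessian_le_shift (WprodT A B τ₀ τ₁) U hL (axisSep_WprodT A B τ₀ τ₁) G hUW hEq
  have hSG := window_G_le_box n M (u := u) hW (K := K) (by omega) (by omega) (by omega) (by omega)
  have hEt := Et_UpT_le_box n M (σ := σ) (b := b) (u := u) (τ₀ := τ₀) (τ₁ := τ₁) (K := K) hτ₀ hτ₀' hτ₁ hτ₁'
  have hS := sqSum_UpT_le_box n M (σ := σ) (b := b) (u := u) (τ₀ := τ₀) (τ₁ := τ₁) (K := K) (by omega) (by omega) (by omega) (by omega)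
  have step1 : ∑ μ, ∑ x, plainWT n M (σ, b) A B τ₀ τ₁ P x * ‖(Pdir (fine n M) (n : ℂ) μ *ᵥ u) x‖ ^ 2
      = (n : ℝ) ^ 4 * sqSum (fun i j => indW (WprodT A B τ₀ τ₁) i j
          * (‖d1 (UpT n M σ b u τ₀ τ₁) i j‖ ^ 2 + ‖d2 (UpT n M σ b u τ₀ τ₁) i j‖ ^ 2)) P := by
    rw [Fin.sum_univ_two, sum_plainWT_mul, sum_plainWT_mul, ← sum_add_distrib, sqSum, mul_sum]
    refine sum_congr rfl fun t _ => ?_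
    rw [← sum_add_distrib, mul_sum]
    refine sum_congr rfl fun s _ => ?_
    rw [Pdir_embT_fst, Pdir_embT_snd, norm_mul, norm_mul, norm_neg, norm_pow, Complex.norm_natCast, mul_pow, mul_pow, ← pow_mul]
    ring
  rw [step1]
  have e : (n : ℝ) ^ 4 * (2 * sqSum (fun i j => indW (WprodT A B τ₀ τ₁) i j * ‖G i j‖ ^ 2) K
        + 32 / (L : ℝ) ^ 2 * Et U K + 16 / (L : ℝ) ^ 4 * sqSum (fun i j => ‖U i j‖ ^ 2) K)
      = 2 * ((n : ℝ) ^ 4 * sqSum (fun i j => indW (WprodT A B τ₀ τ₁) i j * ‖G i j‖ ^ 2) K)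
        + 32 * ((n : ℝ) / L) ^ 2 * ((n : ℝ) ^ 2 * Et U K) + 16 * ((n : ℝ) / L) ^ 4 * sqSum (fun i j => ‖U i j‖ ^ 2) K := by
    field_simp
  calc (n : ℝ) ^ 4 * sqSum (fun i j => indW (WprodT A B τ₀ τ₁) i j * (‖d1 U i j‖ ^ 2 + ‖d2 U i j‖ ^ 2)) P
      ≤ (n : ℝ) ^ 4 * (2 * sqSum (fun i j => indW (WprodT A B τ₀ τ₁) i j * ‖G i j‖ ^ 2) K
        + 32 / (L : ℝ) ^ 2 * Et U K + 16 / (L : ℝ) ^ 4 * sqSum (fun i j => ‖U i j‖ ^ 2) K) :=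
        mul_le_mul_of_nonneg_left hloc (by positivity)
    _ = _ := e
    _ ≤ _ := by
        have h32 : (0 : ℝ) ≤ 32 * ((n : ℝ) / L) ^ 2 := by positivity
        have h16 : (0 : ℝ) ≤ 16 * ((n : ℝ) / L) ^ 4 := by positivity
        exact add_le_add (add_le_add (mul_le_mul_of_nonneg_left hSG zero_le_two) (mul_le_mul_of_nonneg_left hEt h32))
          (mul_le_mul_of_nonneg_left hS h16)

end Window

/-! ## §2 Isolated quadrant pieces -/

section Piece

variable {S : Tor M → Prop} {σ : Fin 2 → Bool} {b : Tor M} {a y : Bool} {u : Tor (fine n M) → ℂ}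

/-- **THE UNWEIGHTED HESSIAN OF AN ISOLATED PIECE WITH STAR-BOX CURRENCIES**: for `u` vanishing off `Ω`, `1 ≤ L`, `4L + c + 3 ≤ n`,
plateau `P = 2L + c − 1`: the same bound as `plainWT_hessian_le_box` (τ = 0). [folklore] -/
theorem pieceW_hessian_le_box [DecidablePred S] (hu : ∀ x, ¬ blockReg n M S x → u x = 0) (hI : IsolatedAt M S σ b a y)
    {L c : ℕ} (hL : 1 ≤ L) (hK : 4 * L + c + 3 ≤ n) :
    ∑ μ, ∑ x, pieceW n M (σ, b) a y (2 * L + c - 1) x * ‖(Pdir (fine n M) (n : ℂ) μ *ᵥ u) x‖ ^ 2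
      ≤ 2 * boxSum n M (fun x => if blockReg n M S x then ‖(LapS (fine n M) (n : ℂ) *ᵥ u) x‖ ^ 2 else 0) σ b
        + 32 * ((n : ℝ) / L) ^ 2 * (boxSum n M (fun x => ‖(sdiff (fine n M) (n : ℂ) 0 *ᵥ u) x‖ ^ 2) σ b
          + boxSum n M (fun x => ‖(sdiff (fine n M) (n : ℂ) 1 *ᵥ u) x‖ ^ 2) σ b)
        + 16 * ((n : ℝ) / L) ^ 4 * boxSum n M (fun x => ‖u x‖ ^ 2) σ b := by
  set K : ℕ := 4 * L + c + 1 with hKdef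
  set P : ℕ := 2 * L + c - 1 with hP
  have hKn : K + 2 ≤ n := by omega
  have hn0 : (0 : ℝ) < n := by exact_mod_cast Nat.pos_of_ne_zero (NeZero.ne n)
  have hn4 : (0 : ℝ) < (n : ℝ) ^ 4 := by positivity
  have hL0 : (0 : ℝ) < L := by exact_mod_cast hL
  set U : ℤ → ℤ → ℂ := Um n M σ b a y u with hU
  set G : ℤ → ℤ → ℂ := fun i j => (LapS (fine n M) (n : ℂ) *ᵥ u) (emb n M σ b i j) / (n : ℂ) ^ 2 with hG
  have hUW : ∀ i j : ℤ, tIdx i ≤ 4 * (L : ℤ) + c → tIdx j ≤ 4 * (L : ℤ) + c → ¬ Quad a y i j → U i j = 0 := by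
    intro i j _ _ hq; rw [hU, Um, if_neg hq]
  have hEq : ∀ i j : ℤ, tIdx i ≤ 4 * (L : ℤ) + c + 1 → tIdx j ≤ 4 * (L : ℤ) + c + 1 → Quad a y i j → lap U i j = G i j := by
    intro i j hi hj hq
    have hi' : -(n : ℤ) + 1 ≤ i ∧ i + 1 < n := by unfold tIdx at hi; split_ifs at hi <;> constructor <;> omega
    have hj' : -(n : ℤ) + 1 ≤ j ∧ j + 1 < n := by unfold tIdx at hj; split_ifs at hj <;> constructor <;> omega
    have hn2 : (n : ℂ) ^ 2 ≠ 0 := pow_ne_zero 2 (by exact_mod_cast NeZero.ne n)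
    show lap U i j = (LapS (fine n M) (n : ℂ) *ᵥ u) (emb n M σ b i j) / (n : ℂ) ^ 2
    rw [hU, (hess_Um_eq n M hu hI hi'.1 hi'.2 hj'.1 hj'.2 hq).2.2, LapS_emb, mul_div_cancel_left₀ _ hn2]
  have hloc := local_hessian_le_shift (Quad a y) U hL (axisSep_Wprod _ _) G hUW hEq
  -- LHS identity: masked = unmasked at piece sites of the plateau
  have hlhs : sqSum (fun i j => indW (Quad a y) i j * (‖d1 (Up n M σ b u) i j‖ ^ 2 + ‖d2 (Up n M σ b u) i j‖ ^ 2)) P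
      = sqSum (fun i j => indW (Quad a y) i j * (‖d1 U i j‖ ^ 2 + ‖d2 U i j‖ ^ 2)) P := by
    refine sum_congr rfl fun t ht => sum_congr rfl fun s hs => ?_
    have ht' := mem_range.mp ht
    have hs' := mem_range.mp hs
    dsimp only
    unfold indW
    split_ifs with hq
    · obtain ⟨e1, e2, -⟩ := hess_Um_eq n M hu hI (i := -(P : ℤ) + s) (j := -(P : ℤ) + t) (by omega) (by omega) (by omega) (by omega) hq
      rw [e1, e2]
    · rw [zero_mul, zero_mul]
  -- the three currencies by star boxes
  set Pf : Tor (fine n M) → ℝ := fun x => if blockReg n M S x then ‖(LapS (fine n M) (n : ℂ) *ᵥ u) x‖ ^ 2 else 0 with hPf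
  have hPf0 : ∀ x, 0 ≤ Pf x := fun x => by rw [hPf]; simp only; split_ifs <;> positivity
  have hSG : (n : ℝ) ^ 4 * sqSum (fun i j => indW (Quad a y) i j * ‖G i j‖ ^ 2) K ≤ boxSum n M Pf σ b := by
    have hterm : ∀ t ∈ range (2 * K), ∀ s ∈ range (2 * K),
        (n : ℝ) ^ 4 * (indW (Quad a y) (-(K : ℤ) + s) (-(K : ℤ) + t) * ‖G (-(K : ℤ) + s) (-(K : ℤ) + t)‖ ^ 2)
          ≤ Pf (emb n M σ b (-(K : ℤ) + s + 0) (-(K : ℤ) + t + 0)) := by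
      intro t ht s hs
      simp only [mem_range] at ht hs
      rw [add_zero, add_zero, indW, hPf, hG]
      simp only
      split_ifs with hq hΩ hΩ
      · rw [one_mul, norm_div, div_pow, norm_pow, Complex.norm_natCast, ← pow_mul, mul_div_cancel₀ _ hn4.ne']
      · exact absurd (blockReg_of_quad n M hI (by omega) (by omega) (by omega) (by omega) hq) hΩ
      · rw [zero_mul, mul_zero]; positivity
      · rw [zero_mul, mul_zero]
    calc (n : ℝ) ^ 4 * sqSum (fun i j => indW (Quad a y) i j * ‖G i j‖ ^ 2) K
        = ∑ t ∈ range (2 * K), ∑ s ∈ range (2 * K),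
            (n : ℝ) ^ 4 * (indW (Quad a y) (-(K : ℤ) + s) (-(K : ℤ) + t) * ‖G (-(K : ℤ) + s) (-(K : ℤ) + t)‖ ^ 2) := by
          rw [sqSum, mul_sum]; simp only [mul_sum]
      _ ≤ ∑ t ∈ range (2 * K), ∑ s ∈ range (2 * K), Pf (emb n M σ b (-(K : ℤ) + s + 0) (-(K : ℤ) + t + 0)) :=
          sum_le_sum fun t ht => sum_le_sum fun s hs => hterm t ht s hs
      _ ≤ boxSum n M Pf σ b := window_le_boxSum n M hPf0 σ b (by omega) (by omega) (by omega) (by omega)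
  have hEt : (n : ℝ) ^ 2 * Et U K ≤ boxSum n M (fun x => ‖(sdiff (fine n M) (n : ℂ) 0 *ᵥ u) x‖ ^ 2) σ b
      + boxSum n M (fun x => ‖(sdiff (fine n M) (n : ℂ) 1 *ᵥ u) x‖ ^ 2) σ b := by
    have hH : EtH U K ≤ EtH (Up n M σ b u) K := by
      rw [EtH, EtH]
      refine sum_le_sum fun t ht => sum_le_sum fun s hs => ?_
      simp only [mem_range] at ht hs
      exact hb_Um_le n M hu hI (by omega) (by omega) (by omega) (by omega)
    have hV : EtV U K ≤ EtV (Up n M σ b u) K := by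
      rw [EtV, EtV]
      refine sum_le_sum fun s hs => sum_le_sum fun t ht => ?_
      simp only [mem_range] at ht hs
      exact vb_Um_le n M hu hI (by omega) (by omega) (by omega) (by omega)
    have h0 := Et_UpT_le_box n M (σ := σ) (b := b) (u := u) (τ₀ := 0) (τ₁ := 0) (K := K) (by omega) (by omega) (by omega) (by omega)
    have eU : Et (UpT n M σ b u 0 0) K = Et (Up n M σ b u) K := by
      rw [Et_eq_rect, Et_eq_rect, EtH, EtH, EtV, EtV]; simp only [hb_UpT, vb_UpT, add_zero]
    rw [eU, Et_eq_rect] at h0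
    rw [Et_eq_rect, mul_add]
    calc (n : ℝ) ^ 2 * EtH U K + (n : ℝ) ^ 2 * EtV U K ≤ (n : ℝ) ^ 2 * EtH (Up n M σ b u) K + (n : ℝ) ^ 2 * EtV (Up n M σ b u) K :=
          add_le_add (mul_le_mul_of_nonneg_left hH (by positivity)) (mul_le_mul_of_nonneg_left hV (by positivity))
      _ ≤ _ := by rw [← mul_add]; exact h0
  have hS : sqSum (fun i j => ‖U i j‖ ^ 2) K ≤ boxSum n M (fun x => ‖u x‖ ^ 2) σ b := by
    have h0 := sqSum_UpT_le_box n M (σ := σ) (b := b) (u := u) (τ₀ := 0) (τ₁ := 0) (K := K) (by omega) (by omega) (by omega) (by omega)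
    refine le_trans (DirichletRingHessianWindow.sqSum_le_of_le (fun i j => normSq_Um_le n M i j) K) (le_trans (le_of_eq ?_) h0)
    unfold sqSum UpT; simp only [add_zero]
  have step1 : ∑ μ, ∑ x, pieceW n M (σ, b) a y P x * ‖(Pdir (fine n M) (n : ℂ) μ *ᵥ u) x‖ ^ 2
      = (n : ℝ) ^ 4 * sqSum (fun i j => indW (Quad a y) i j * (‖d1 (Up n M σ b u) i j‖ ^ 2 + ‖d2 (Up n M σ b u) i j‖ ^ 2)) P := by
    rw [Fin.sum_univ_two, sum_pieceW_mul, sum_pieceW_mul, ← sum_add_distrib, sqSum, mul_sum]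
    refine sum_congr rfl fun t _ => ?_
    rw [← sum_add_distrib, mul_sum]
    refine sum_congr rfl fun s _ => ?_
    rw [Pdir_emb_fst, Pdir_emb_snd, norm_mul, norm_mul, norm_neg, norm_pow, Complex.norm_natCast, mul_pow, mul_pow, ← pow_mul]
    ring
  rw [step1, hlhs]
  have e : (n : ℝ) ^ 4 * (2 * sqSum (fun i j => indW (Quad a y) i j * ‖G i j‖ ^ 2) K
        + 32 / (L : ℝ) ^ 2 * Et U K + 16 / (L : ℝ) ^ 4 * sqSum (fun i j => ‖U i j‖ ^ 2) K)
      = 2 * ((n : ℝ) ^ 4 * sqSum (fun i j => indW (Quad a y) i j * ‖G i j‖ ^ 2) K)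
        + 32 * ((n : ℝ) / L) ^ 2 * ((n : ℝ) ^ 2 * Et U K) + 16 * ((n : ℝ) / L) ^ 4 * sqSum (fun i j => ‖U i j‖ ^ 2) K := by
    field_simp
  calc (n : ℝ) ^ 4 * sqSum (fun i j => indW (Quad a y) i j * (‖d1 U i j‖ ^ 2 + ‖d2 U i j‖ ^ 2)) P
      ≤ (n : ℝ) ^ 4 * (2 * sqSum (fun i j => indW (Quad a y) i j * ‖G i j‖ ^ 2) K
        + 32 / (L : ℝ) ^ 2 * Et U K + 16 / (L : ℝ) ^ 4 * sqSum (fun i j => ‖U i j‖ ^ 2) K) :=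
        mul_le_mul_of_nonneg_left hloc (by positivity)
    _ = _ := e
    _ ≤ _ := by
        have h32 : (0 : ℝ) ≤ 32 * ((n : ℝ) / L) ^ 2 := by positivity
        have h16 : (0 : ℝ) ≤ 16 * ((n : ℝ) / L) ^ 4 := by positivity
        exact add_le_add (add_le_add (mul_le_mul_of_nonneg_left hSG zero_le_two) (mul_le_mul_of_nonneg_left hEt h32))
          (mul_le_mul_of_nonneg_left hS h16)

end Piece

end Summit.QuantumFields.BalabanUV.Beta.GAN24.DirichletVertexWindowLocal

end
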